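import Summits.HodgeConjecture.FermatCycles.ConditionQFourfoldSearch
import Summits.HodgeConjecture.FermatCycles.ConditionQFourfoldEightyFourTable
import Summits.HodgeConjecture.FermatCycles.ConditionQFourfoldEightyFourA
import Summits.HodgeConjecture.FermatCycles.ConditionQFourfoldEightyFourB
import Summits.HodgeConjecture.FermatCycles.ConditionQFourfoldEightyFourC
import Summits.HodgeConjecture.FermatCycles.ConditionQFourfoldEightyFourD
import Summits.HodgeConjecture.FermatCycles.ConditionQFourfoldEightyFourE
import HarnessLib

/-!
# Shioda's stable-generation condition `(Q⁴ₘ)` at `m = 84` and the failure of `(P⁴ₘ)` — kernel certificate (part F of 6)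

HONEST FRAMING: explicit algebraic cycles for specific Hodge classes on Fermat/Delsarte varieties;
residual open instances listed; no claim on general Hodge.

Topic path `Summits/HodgeConjecture/FermatCycles/` of cell `pub-hfermat` (new work, not literature: a computer determination of the cell —
`pub-hfermat-enum/P4-TABLE.md` §(Q⁴ₘ), two implementations — certified by the Lean kernel). Framework: `ConditionQFourfold.lean`
(certificate Booleans, searches `checkQU`/`checkQN`) and `ConditionQFourfoldSearch.lean` (`conditionQ_four_of_normalized`).

THE STATEMENT. Shioda, Math. Ann. 245 (1979) §4 p. 183: `(Qⁿₘ)` — every element of `Mₘ(y)`, `3 ≤ y ≤ n/2 + 1`, is `ξ₁ − ξ₂` with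
`ξ₁, ξ₂ ∈ M'ₘ = ⟨Mₘ(1), Mₘ(2), Mₘ(3)^sd⟩` (pairs, Hodge classes of the Fermat surface, semi-decomposable sextuples); by his Claim
(p. 183, Lemmas 2–3) `(Qⁿₘ)` may replace `(Pⁿₘ)` in Theorem III (`⇒` the Hodge conjecture for `Xⁿₘ`); p. 184: "we do not know any
value of `m` which satisfies `(Qₘ)` but not `(Pₘ)`". Tree: `Literature.AlgebraicGeometry.Shioda1979.ConditionQ m n`, `MPrime`,
`forall_of_conditionQ` (the Claim's arithmetic spine), `ConditionP` (Math. Ann. form of `(P)`), `FermatCharacter.ShiodaConditionUpTo`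
(Proc. Japan Acad. form, with the semi-decomposable alternative).

WHAT IS PROVED HERE (level `m = 84`, part F).
* part F of 6: the kernel searches `checkQN 84 T 18 2`, `checkQN 84 T 20 2`, `checkQN 84 T 22 3`, `checkQN 84 T 25 59` (193537 tuples);
* **`conditionQ_eightyFour_four : Shioda1979.ConditionQ 84 4`** — `(Q⁴ₘ)` holds at `m = 84`: every Hodge sextuple over `ℤ/84` (every Hodge character of the
  Fermat fourfold `X⁴ₘ`, `m = 84`, up to permutation) is `ξ₁ − ξ₂`, `ξᵢ ∈ M'ₘ`;
* `forall_of_closed_cancellative_eightyFour`: by Shioda's Claim (`forall_of_conditionQ`), every Shioda-closed, Lemma-3-cancellative family of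
  multisets over `ℤ/84` contains every non-empty Hodge multiset of cardinality `≤ 6`;
* the NEGATIVE side on the sextuple `s = (1, 6, 13, 69, 81, 82)`: Hodge (`isHodgeMultiset_fail_eightyFour`), no proper non-empty sub-multiset with
  zero sum (`sum_ne_zero_of_mem_powerset_fail_eightyFour`: hence not decomposable, not semi-decomposable), not quasi-decomposable (`fail_eightyFour_key`,
  `84 · 2⁸` kernel cases) ⇒ **`not_shiodaConditionUpTo_eightyFour_four : ¬ ShiodaConditionUpTo 84 4`** (the Proc. Japan Acad. form of `(P⁴ₘ)`
  fails), `not_conditionP_eightyFour_four : ¬ Shioda1979.ConditionP 84 4` (the Math. Ann. form fails), and the conjunction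
  `conditionQ_not_conditionP_eightyFour : ConditionQ 84 4 ∧ ¬ ConditionP 84 4` — at `m = 84`, for fourfolds, Shioda's weakening `(Q)` of `(P)` is
  NECESSARY as well as sufficient.

NUMBERS (this seat's search `code/lit/q4/q4norm.py` = implementation 2; implementation 1 = ENUM `code/enum/q4table.py`,
`data/shioda_Q4_m3-100.json`): case U visits 203105 sorted tuples and case N 667273; 18936 of them are Hodge sextuples; all but 98 carry a
`(P)`-witness (case N pair 13120, case N quasi 3362, case N semi 522, case U pair 1599, case U quasi 227, case U semi 8); the other 98 — `(1, 6, 13, 69, 81, 82)` (case U); `(1, 12, 13, 69, 76, 81)` (case U); `(1, 13, 28, 51, 77, 82)` (case U); `(1, 13, 28, 58, 75, 77)` (case U); `(1, 13, 30, 58, 69, 81)` (case U); `(1, 13, 38, 50, 69, 81)` (case U); `(1, 13, 45, 54, 57, 82)` (case U); `(1, 13, 45, 57, 58, 78)` (case U); `(1, 13, 45, 57, 62, 74)` (case U); `(1, 13, 45, 57, 64, 72)` (case U); `(1, 13, 49, 51, 56, 82)` (case U); `(1, 13, 49, 56, 58, 75)` (case U); `(1, 25, 37, 43, 67, 79)`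 (case U); `(1, 25, 38, 43, 67, 78)` (case U); `(1, 26, 29, 45, 69, 82)` (case U); `(1, 28, 29, 51, 66, 77)` (case U); `(1, 29, 30, 43, 71, 78)` (case U); `(1, 29, 30, 45, 69, 78)` (case U); `(1, 29, 42, 45, 66, 69)` (case U); `(1, 29, 45, 48, 60, 69)` (case U); `(1, 29, 49, 51, 56, 66)` (case U); `(1, 30, 32, 43, 68, 78)` (case U); `(1, 30, 37, 43, 62, 79)` (case U); `(1, 30, 38, 43, 62, 78)` (case U); `(1, 32, 33, 43, 68, 75)` (case U); `(1, 33, 38, 43, 62, 75)` (case U); `(2, 4, 39, 50, 76, 81)` (case N); `(2, 15, 39, 57, 58, 81)` (case N); `(2, 15, 40, 57, 64, 74)` (case N); `(2, 15, 46, 57, 58, 74)` (case N); `(2, 15, 46, 57, 64, 68)` (case N); `(2, 22, 32, 39, 76, 81)` (case N); `(2, 22, 39, 50, 58, 81)` (case N); `(3, 8, 34, 45, 80, 82)` (case N); `(3, 8, 45, 52, 62, 82)` (case N); `(3, 8, 45, 52, 64, 80)` (case N); `(3, 15, 28, 51, 77, 78)` (case N); `(3, 15, 28, 54, 75, 77)`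 (case N); `(3, 15, 49, 51, 56, 78)` (case N); `(3, 15, 49, 54, 56, 75)` (case N); `(3, 26, 27, 45, 69, 82)` (case N); `(3, 26, 34, 45, 62, 82)` (case N); `(3, 26, 34, 45, 64, 80)` (case N); `(3, 26, 45, 52, 62, 64)` (case N); `(3, 27, 28, 51, 66, 77)` (case N); `(3, 27, 49, 51, 56, 66)` (case N); `(3, 33, 34, 45, 62, 75)` (case N); `(4, 10, 33, 62, 68, 75)` (case N); `(4, 20, 32, 39, 76, 81)` (case N); `(4, 20, 32, 54, 66, 76)` (case N); `(4, 20, 39, 50, 58, 81)` (case N); `(4, 30, 32, 40, 68, 78)` (case N); `(4, 32, 33, 40, 68, 75)` (case N); `(4, 33, 38, 40, 62, 75)` (case N); `(6, 7, 33, 56, 69, 81)` (case N); `(6, 8, 40, 64, 66, 68)` (case N); `(6, 16, 44, 52, 54, 80)` (case N); `(6, 27, 28, 39, 75, 77)` (case N); `(6, 27, 39, 49, 56, 75)` (case N); `(6, 28, 33, 35, 69, 81)` (case N); `(7, 9, 30, 56, 69, 81)` (case N); `(7, 9, 45, 56, 57, 78)` (case N); `(7, 9, 45, 56, 66, 69)`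 (case N); `(7, 18, 33, 56, 57, 81)` (case N); `(7, 33, 45, 54, 56, 57)` (case N); `(8, 15, 40, 57, 58, 74)` (case N); `(8, 15, 40, 57, 64, 68)` (case N); `(8, 15, 46, 57, 58, 68)` (case N); `(8, 18, 30, 52, 64, 80)` (case N); `(9, 15, 46, 51, 57, 74)` (case N); `(9, 16, 22, 51, 74, 80)` (case N); `(9, 16, 44, 51, 52, 80)` (case N); `(9, 16, 50, 51, 52, 74)` (case N); `(9, 22, 39, 50, 51, 81)` (case N); `(9, 22, 44, 46, 51, 80)` (case N); `(9, 22, 46, 50, 51, 74)` (case N); `(9, 28, 30, 35, 69, 81)` (case N); `(9, 28, 35, 45, 57, 78)` (case N); `(9, 28, 35, 45, 66, 69)` (case N); `(9, 44, 46, 50, 51, 52)` (case N); `(10, 20, 27, 44, 69, 82)` (case N); `(10, 26, 27, 38, 69, 82)` (case N); `(10, 26, 27, 44, 69, 76)` (case N); `(10, 27, 33, 38, 69, 75)` (case N); `(10, 32, 33, 34, 68, 75)` (case N); `(10, 33, 34, 38, 62, 75)` (case N); `(15, 18, 28, 39, 75, 77)` (case N); `(15, 18, 39, 49, 56, 75)`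 (case N); `(16, 18, 20, 44, 76, 78)` (case N); `(16, 20, 27, 38, 69, 82)` (case N); `(16, 20, 27, 44, 69, 76)` (case N); `(16, 26, 27, 38, 69, 76)` (case N); `(18, 28, 33, 35, 57, 81)` (case N); `(20, 22, 32, 39, 58, 81)` (case N); `(27, 28, 30, 39, 51, 77)` (case N); `(27, 30, 39, 49, 51, 56)` (case N); `(28, 33, 35, 45, 54, 57)` (case N); `(32, 33, 34, 38, 40, 75)` (case N) — carry the table
certificate(s) written out in the statements below (generators checked by `genB`, the identity `s + ΣX = ΣY` by `decide`, all inside the kernel search).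

PRINT STATUS (lit seat, 2026-08-20). `84 = 2²·3·7`: HC for every `Xⁿ₈₄` IS in print (Aoki 2000 Thm 0.1 (i), p. 185). The point of this level is Shioda's QUESTION (p. 184): `(Q⁴₈₄)` holds while `(P⁴₈₄)` fails (98 sextuples without a `(P)`-witness; cell table, two implementations; kernel here).

References: [Shioda1979HodgeFermat] T. Shioda, Math. Ann. 245 (1979) 175–184, §3 p. 180 (`(Pⁿₘ)`), §4 pp. 183–184 (`M'ₘ`, `(Qⁿₘ)`, Claim,
the question); [Shioda1979PJA] T. Shioda, Proc. Japan Acad. 55A (1979) §1 (Definition (i)–(iii), `(Pⁿₘ)'`); [daSilva2021HodgeFermat]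
G. da Silva Jr., Experimental Results 2 (2021) e22, Def. 2.4, Question 1; [Aoki2000FermatTypeRemarks] N. Aoki, Comment. Math. Univ.
St. Pauli 49 (2000), Thm 0.1. Cell: `pub-hfermat-enum/P4-TABLE.md`, `data/shioda_Q4_m3-100.json`, `code/lit/q4/` (this seat).
-/

namespace Summit.HodgeConjecture.FermatCycles.ConditionQFourfold

open Multiset
open Literature.AlgebraicGeometry.HodgeTheory Literature.AlgebraicGeometry.HodgeTheory.FermatCharacter
open Literature.AlgebraicGeometry.Shioda1982 Literature.AlgebraicGeometry.Shioda1979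
open Summit.HodgeConjecture.FermatCycles.ShiodaConditionFourfold

/-! ### Level `84` — part F -/

/-! The certificate table at level `84` is the definition `table84` of `ConditionQFourfoldEightyFourTable.lean` (98 entries `(key, X, Y)`,
`s + ΣX = ΣY`; found by `code/lit/q4/q4norm.py`, every entry checked by the kernel inside the searches). -/

set_option maxHeartbeats 0 in
/-- The `(Q)`-search at level `84`, case N, first free representative in `[18, 20)` (38042 tuples). Kernel.
[cite: Shioda1979HodgeFermat, §4 condition (Qⁿₘ), p. 183] -/
theorem checkQN_84_18 :
    checkQN 84
      table84
      18 2 = true := by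
  decide +kernel

set_option maxHeartbeats 0 in
/-- The `(Q)`-search at level `84`, case N, first free representative in `[20, 22)` (61138 tuples). Kernel.
[cite: Shioda1979HodgeFermat, §4 condition (Qⁿₘ), p. 183] -/
theorem checkQN_84_20 :
    checkQN 84
      table84
      20 2 = true := by
  decide +kernel

set_option maxHeartbeats 0 in
/-- The `(Q)`-search at level `84`, case N, first free representative in `[22, 25)` (43084 tuples). Kernel.
[cite: Shioda1979HodgeFermat, §4 condition (Qⁿₘ), p. 183] -/
theorem checkQN_84_22 :
    checkQN 84
      table84
      22 3 = true := by
  decide +kernel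

set_option maxHeartbeats 0 in
/-- The `(Q)`-search at level `84`, case N, first free representative in `[25, 84)` (51273 tuples). Kernel.
[cite: Shioda1979HodgeFermat, §4 condition (Qⁿₘ), p. 183] -/
theorem checkQN_84_25 :
    checkQN 84
      table84
      25 59 = true := by
  decide +kernel

/-- **`(Q⁴ₘ)` holds at `m = 84`**: every Hodge sextuple over `ℤ/84` is `ξ₁ − ξ₂` with `ξ₁, ξ₂ ∈ M'ₘ` (stably generated by pairs, Hodge
`4`-sets and semi-decomposable sextuples). Kernel certificate of the cell's entry `84 ∈ Q4_true_P4_false` (P4-TABLE §(Q⁴ₘ)).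
[cite: Shioda1979HodgeFermat, §4 condition (Qⁿₘ), p. 183] -/
theorem conditionQ_eightyFour_four : ConditionQ 84 4 :=
  haveI : Fact (1 < 84) := ⟨by norm_num⟩
  conditionQ_four_of_normalized 84
    table84
    [(1, 19), (20, 64)]
    (by
      intro b h0 hN
      rcases Nat.lt_or_ge b 20 with h0 | h0
      · exact ⟨(1, 19), by simp, by omega, by omega⟩
      exact ⟨(20, 64), by simp, by omega, by omega⟩)
    (by
      intro p hp
      simp only [List.mem_cons, List.not_mem_nil, or_false] at hp
      rcases hp with rfl | rfl
      · exact checkQU_84_1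
      · exact checkQU_84_20)
    [(1, 2), (3, 1), (4, 2), (6, 1), (7, 1), (8, 1), (9, 1), (10, 2), (12, 3), (15, 3), (18, 2), (20, 2), (22, 3), (25, 59)]
    (by
      intro a h0 hN
      rcases Nat.lt_or_ge a 3 with h0 | h0
      · exact ⟨(1, 2), by simp, by omega, by omega⟩
      rcases Nat.lt_or_ge a 4 with h1 | h1
      · exact ⟨(3, 1), by simp, by omega, by omega⟩
      rcases Nat.lt_or_ge a 6 with h2 | h2
      · exact ⟨(4, 2), by simp, by omega, by omega⟩
      rcases Nat.lt_or_ge a 7 with h3 | h3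
      · exact ⟨(6, 1), by simp, by omega, by omega⟩
      rcases Nat.lt_or_ge a 8 with h4 | h4
      · exact ⟨(7, 1), by simp, by omega, by omega⟩
      rcases Nat.lt_or_ge a 9 with h5 | h5
      · exact ⟨(8, 1), by simp, by omega, by omega⟩
      rcases Nat.lt_or_ge a 10 with h6 | h6
      · exact ⟨(9, 1), by simp, by omega, by omega⟩
      rcases Nat.lt_or_ge a 12 with h7 | h7
      · exact ⟨(10, 2), by simp, by omega, by omega⟩
      rcases Nat.lt_or_ge a 15 with h8 | h8
      · exact ⟨(12, 3), by simp, by omega, by omega⟩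
      rcases Nat.lt_or_ge a 18 with h9 | h9
      · exact ⟨(15, 3), by simp, by omega, by omega⟩
      rcases Nat.lt_or_ge a 20 with h10 | h10
      · exact ⟨(18, 2), by simp, by omega, by omega⟩
      rcases Nat.lt_or_ge a 22 with h11 | h11
      · exact ⟨(20, 2), by simp, by omega, by omega⟩
      rcases Nat.lt_or_ge a 25 with h12 | h12
      · exact ⟨(22, 3), by simp, by omega, by omega⟩
      exact ⟨(25, 59), by simp, by omega, by omega⟩)
    (by
      intro p hp
      simp only [List.mem_cons, List.not_mem_nil, or_false] at hp
      rcases hp with rfl | rfl | rfl | rfl | rfl | rfl | rfl | rfl | rfl | rfl | rfl | rfl | rfl | rfl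
      · exact checkQN_84_1
      · exact checkQN_84_3
      · exact checkQN_84_4
      · exact checkQN_84_6
      · exact checkQN_84_7
      · exact checkQN_84_8
      · exact checkQN_84_9
      · exact checkQN_84_10
      · exact checkQN_84_12
      · exact checkQN_84_15
      · exact checkQN_84_18
      · exact checkQN_84_20
      · exact checkQN_84_22
      · exact checkQN_84_25)

/-- **Shioda's Claim at `m = 84`**: every family of multisets over `ℤ/84` closed under the inductive structure of Fermat varieties
(pairs, surface classes, semi / star / hash) and under Lemma 3's cancellation contains every non-empty Hodge multiset with at most `6`
elements — the arithmetic form of "`(Q⁴ₘ)` ⇒ the Hodge conjecture for `X⁴ₘ`" at `m = 84` (geometric inputs = the hypotheses, as printed).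
[cite: Shioda1979HodgeFermat, §4 Claim, Lemmas 2–3, p. 183] -/
theorem forall_of_closed_cancellative_eightyFour {C : Multiset (ZMod 84) → Prop} (hC : IsShiodaClosed C) (hL : IsCancellative C) :
    ∀ s : Multiset (ZMod 84), s ≠ 0 → IsHodgeMultiset s → card s ≤ 6 → C s :=
  forall_of_conditionQ hC hL conditionQ_eightyFour_four

/-! ### The negative side at `m = 84`: `(P⁴ₘ)` fails on `s = (1, 6, 13, 69, 81, 82)` -/

/-- `s` is a Hodge sextuple over `ℤ/84` (a Hodge character of the Fermat fourfold of degree `84`). [cite: Shioda1979PJA, §1 eqs. (2)–(3)] -/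
theorem isHodgeMultiset_fail_eightyFour : IsHodgeMultiset ({1, 6, 13, 69, 81, 82} : Multiset (ZMod 84)) :=
  isHodgeMultiset_of_hodgeUB (N := 84) (by decide +kernel)

/-- Every proper non-empty sub-multiset of `s` has non-zero sum: `s` contains no pair `{a, −a}`, no Hodge sub-multiset, no zero-sum
triple. [cite: Shioda1979PJA, §1 Definition (i), (iii)] -/
theorem sum_ne_zero_of_mem_powerset_fail_eightyFour :
    ∀ t ∈ Multiset.powerset ({1, 6, 13, 69, 81, 82} : Multiset (ZMod 84)), t ≠ 0 → ({1, 6, 13, 69, 81, 82} : Multiset (ZMod 84)) - t ≠ 0 → t.sum ≠ 0 := by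
  decide +kernel

/-- `s` is **not decomposable** (a summand would be a proper non-empty zero-sum sub-multiset). [cite: Shioda1979PJA, §1 Definition (i)] -/
theorem not_isDecomposable_fail_eightyFour : ¬ IsDecomposable ({1, 6, 13, 69, 81, 82} : Multiset (ZMod 84)) := by
  rintro ⟨t, u, ht0, hu0, ht, -, heq⟩
  have htle : t ≤ ({1, 6, 13, 69, 81, 82} : Multiset (ZMod 84)) := heq ▸ Multiset.le_add_right t u
  have hu : ({1, 6, 13, 69, 81, 82} : Multiset (ZMod 84)) - t = u := by rw [heq, add_tsub_cancel_left]
  exact sum_ne_zero_of_mem_powerset_fail_eightyFour t (Multiset.mem_powerset.2 htle) ht0 (hu ▸ hu0) ht.1.2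

/-- `s` is **not semi-decomposable** (no zero-sum triple). [cite: Shioda1979PJA, §1 Definition (iii)] -/
theorem not_isSemiDecomposable_fail_eightyFour : ¬ IsSemiDecomposable ({1, 6, 13, 69, 81, 82} : Multiset (ZMod 84)) := by
  rintro ⟨t, u, ht3, hu3, hts, -, heq⟩
  have htle : t ≤ ({1, 6, 13, 69, 81, 82} : Multiset (ZMod 84)) := heq ▸ Multiset.le_add_right t u
  have hu : ({1, 6, 13, 69, 81, 82} : Multiset (ZMod 84)) - t = u := by rw [heq, add_tsub_cancel_left]
  have ht0 : t ≠ 0 := by rintro rfl; simp at ht3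
  have hu0 : u ≠ 0 := by rintro rfl; simp at hu3
  exact sum_ne_zero_of_mem_powerset_fail_eightyFour t (Multiset.mem_powerset.2 htle) ht0 (hu ▸ hu0) hts

/-- A Hodge multiset over `ℤ/84` satisfies the finitely many conditions used by the kernel refutation below (entries non-zero, sum
zero, Shioda's norm equation at the units `1, 11, 13, 17, 23, 29` — a sub-family of Shioda's equations (2) that already admits no splitting, chosen by
`code/lit/q4/minunits.py`). [cite: Shioda1979PJA, §1 eq. (2)] -/
theorem hodgeConditions_eightyFour {v : Multiset (ZMod 84)} (hv : IsHodgeMultiset v) :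
    ((v).sum = 0 ∧ (∀ a ∈ v, a ≠ 0) ∧
            2 * mNormSum ((v).map fun a ↦ (1 : ZMod 84) * a) = 84 * Multiset.card (v) ∧
            2 * mNormSum ((v).map fun a ↦ (11 : ZMod 84) * a) = 84 * Multiset.card (v) ∧
            2 * mNormSum ((v).map fun a ↦ (13 : ZMod 84) * a) = 84 * Multiset.card (v) ∧
            2 * mNormSum ((v).map fun a ↦ (17 : ZMod 84) * a) = 84 * Multiset.card (v) ∧
            2 * mNormSum ((v).map fun a ↦ (23 : ZMod 84) * a) = 84 * Multiset.card (v) ∧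
            2 * mNormSum ((v).map fun a ↦ (29 : ZMod 84) * a) = 84 * Multiset.card (v)) := by
  have h1 := hv.2 (Units.mkOfMulEqOne 1 1 (by decide))
  have h11 := hv.2 (Units.mkOfMulEqOne 11 23 (by decide))
  have h13 := hv.2 (Units.mkOfMulEqOne 13 13 (by decide))
  have h17 := hv.2 (Units.mkOfMulEqOne 17 5 (by decide))
  have h23 := hv.2 (Units.mkOfMulEqOne 23 11 (by decide))
  have h29 := hv.2 (Units.mkOfMulEqOne 29 29 (by decide))
  simp only [Units.val_mkOfMulEqOne] at h1 h11 h13 h17 h23 h29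
  exact ⟨hv.1.2, hv.1.1, h1, h11, h13, h17, h23, h29⟩

set_option maxHeartbeats 0 in
/-- The arithmetic heart of "`s` is **not quasi-decomposable**": for every `e ∈ ℤ/84` and every splitting `s + {e, −e} = t + u` into
non-empty parts different from `s`, one of `t`, `u` violates a condition of `hodgeConditions_eightyFour` (the zero-sum test comes first, so
the kernel discards almost every splitting on one addition). Kernel, one residue `e` at a time (`84 · 2⁸` cases). [cite: daSilva2021HodgeFermat, Def. 2.4] [cite: Shioda1979PJA, §1 Definition (ii)] -/
theorem fail_eightyFour_key :
    ∀ e : ZMod 84, ∀ t ∈ Multiset.powerset (({1, 6, 13, 69, 81, 82} : Multiset (ZMod 84)) + {e, -e}),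
      ¬ (((t).sum = 0 ∧ (∀ a ∈ t, a ≠ 0) ∧
            2 * mNormSum ((t).map fun a ↦ (1 : ZMod 84) * a) = 84 * Multiset.card (t) ∧
            2 * mNormSum ((t).map fun a ↦ (11 : ZMod 84) * a) = 84 * Multiset.card (t) ∧
            2 * mNormSum ((t).map fun a ↦ (13 : ZMod 84) * a) = 84 * Multiset.card (t) ∧
            2 * mNormSum ((t).map fun a ↦ (17 : ZMod 84) * a) = 84 * Multiset.card (t) ∧
            2 * mNormSum ((t).map fun a ↦ (23 : ZMod 84) * a) = 84 * Multiset.card (t) ∧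
            2 * mNormSum ((t).map fun a ↦ (29 : ZMod 84) * a) = 84 * Multiset.card (t)) ∧
          (((({1, 6, 13, 69, 81, 82} : Multiset (ZMod 84)) + {e, -e}) - t).sum = 0 ∧ (∀ a ∈ (({1, 6, 13, 69, 81, 82} : Multiset (ZMod 84)) + {e, -e}) - t, a ≠ 0) ∧
            2 * mNormSum (((({1, 6, 13, 69, 81, 82} : Multiset (ZMod 84)) + {e, -e}) - t).map fun a ↦ (1 : ZMod 84) * a) = 84 * Multiset.card ((({1, 6, 13, 69, 81, 82} : Multiset (ZMod 84)) + {e, -e}) - t) ∧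
            2 * mNormSum (((({1, 6, 13, 69, 81, 82} : Multiset (ZMod 84)) + {e, -e}) - t).map fun a ↦ (11 : ZMod 84) * a) = 84 * Multiset.card ((({1, 6, 13, 69, 81, 82} : Multiset (ZMod 84)) + {e, -e}) - t) ∧
            2 * mNormSum (((({1, 6, 13, 69, 81, 82} : Multiset (ZMod 84)) + {e, -e}) - t).map fun a ↦ (13 : ZMod 84) * a) = 84 * Multiset.card ((({1, 6, 13, 69, 81, 82} : Multiset (ZMod 84)) + {e, -e}) - t) ∧
            2 * mNormSum (((({1, 6, 13, 69, 81, 82} : Multiset (ZMod 84)) + {e, -e}) - t).map fun a ↦ (17 : ZMod 84) * a) = 84 * Multiset.card ((({1, 6, 13, 69, 81, 82} : Multiset (ZMod 84)) + {e, -e}) - t) ∧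
            2 * mNormSum (((({1, 6, 13, 69, 81, 82} : Multiset (ZMod 84)) + {e, -e}) - t).map fun a ↦ (23 : ZMod 84) * a) = 84 * Multiset.card ((({1, 6, 13, 69, 81, 82} : Multiset (ZMod 84)) + {e, -e}) - t) ∧
            2 * mNormSum (((({1, 6, 13, 69, 81, 82} : Multiset (ZMod 84)) + {e, -e}) - t).map fun a ↦ (29 : ZMod 84) * a) = 84 * Multiset.card ((({1, 6, 13, 69, 81, 82} : Multiset (ZMod 84)) + {e, -e}) - t)) ∧
          t ≠ 0 ∧ (({1, 6, 13, 69, 81, 82} : Multiset (ZMod 84)) + {e, -e}) - t ≠ 0 ∧ t ≠ ({1, 6, 13, 69, 81, 82} : Multiset (ZMod 84)) ∧ (({1, 6, 13, 69, 81, 82} : Multiset (ZMod 84)) + {e, -e}) - t ≠ ({1, 6, 13, 69, 81, 82} : Multiset (ZMod 84))) := by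
  intro e
  obtain ⟨k, hk, rfl⟩ : ∃ k < 84, ((k : ℕ) : ZMod 84) = e :=
    ⟨e.val, e.val_lt, ZMod.natCast_zmod_val e⟩
  interval_cases k <;> decide +kernel

/-- `s` is **not quasi-decomposable** (no `e ≠ 0` with `s + {e, −e} = ξ' + ξ''`, `ξ', ξ''` Hodge, both different from `s`).
[cite: daSilva2021HodgeFermat, Def. 2.4] [cite: Shioda1979PJA, §1 Definition (ii)] -/
theorem not_isQuasiDecomposable_fail_eightyFour : ¬ IsQuasiDecomposable ({1, 6, 13, 69, 81, 82} : Multiset (ZMod 84)) := by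
  rintro ⟨e, -, t, u, ht0, hu0, ht, hu, hts, hus, heq⟩
  have htle : t ≤ ({1, 6, 13, 69, 81, 82} : Multiset (ZMod 84)) + {e, -e} := heq ▸ Multiset.le_add_right t u
  have hu' : ({1, 6, 13, 69, 81, 82} : Multiset (ZMod 84)) + {e, -e} - t = u := by rw [heq, add_tsub_cancel_left]
  subst hu'
  exact fail_eightyFour_key e t (Multiset.mem_powerset.2 htle)
    ⟨hodgeConditions_eightyFour ht, hodgeConditions_eightyFour hu, ht0, hu0, hts, hus⟩

/-- **`(P⁴ₘ)` fails at `m = 84`** (Proc. Japan Acad. form, tree `ShiodaConditionUpTo 84 4`): the Hodge sextuple `s` is neither decomposable,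
nor quasi-decomposable, nor semi-decomposable. Kernel certificate of the cell's P4-TABLE entry (two implementations + referee).
[cite: Shioda1979PJA, §1 condition (Pⁿₘ)] -/
theorem not_shiodaConditionUpTo_eightyFour_four : ¬ ShiodaConditionUpTo 84 4 := fun h ↦ by
  rcases h _ isHodgeMultiset_fail_eightyFour (by decide) (by decide) with hd | hq | hs
  · exact not_isDecomposable_fail_eightyFour hd
  · exact not_isQuasiDecomposable_fail_eightyFour hq
  · exact not_isSemiDecomposable_fail_eightyFour hs

/-- Hence `(Pₘ)` (Proc. Japan Acad. form, all lengths) fails at `m = 84`. [cite: Shioda1979PJA, §1 conditions (Pⁿₘ), (Pₘ)] -/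
theorem not_shiodaCondition_eightyFour : ¬ ShiodaCondition 84 := fun h ↦
  not_shiodaConditionUpTo_eightyFour_four (shiodaCondition_iff_forall_upTo.1 h 4)

/-- **The Math. Ann. form of `(P⁴ₘ)` fails at `m = 84`** too: `s` is indecomposable and not quasi-decomposable.
[cite: Shioda1979HodgeFermat, §3 condition (Pⁿₘ), p. 180] -/
theorem not_conditionP_eightyFour_four : ¬ ConditionP 84 4 := fun h ↦
  not_isQuasiDecomposable_fail_eightyFour
    (h _ isHodgeMultiset_fail_eightyFour (by decide) (by decide) not_isDecomposable_fail_eightyFour)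

/-- Hence the Math. Ann. condition `(Pₘ)` fails at `m = 84`. [cite: Shioda1979HodgeFermat, §3 condition (Pₘ), p. 180] -/
theorem not_conditionPAll_eightyFour : ¬ ConditionPAll 84 := fun h ↦
  not_conditionP_eightyFour_four (conditionPAll_iff_forall.1 h 4)

/-- **Shioda's question (Math. Ann. 245, p. 184), the fourfold instance at `m = 84`**: "we do not know any value of `m` which satisfies
`(Qₘ)` but not `(Pₘ)`" — at `m = 84` the length-`3` condition `(Q⁴ₘ)` HOLDS while `(P⁴ₘ)` FAILS (in both printed forms). Whether `(Qₘ)` holds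
at ALL lengths for `m = 84` is not decided here. Computer-assisted (cell `pub-hfermat`, two implementations), certified by the kernel.
[cite: Shioda1979HodgeFermat, §4, p. 184 (the question)] -/
theorem conditionQ_not_conditionP_eightyFour : ConditionQ 84 4 ∧ ¬ ConditionP 84 4 :=
  ⟨conditionQ_eightyFour_four, not_conditionP_eightyFour_four⟩

end Summit.HodgeConjecture.FermatCycles.ConditionQFourfold
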